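import Literature.AlgebraicGeometry.GroupSchemes.KernelOfLiftedMultipleKilledBySquare
import Literature.AlgebraicGeometry.GroupSchemes.BarsottiTateGroupQuotientMaps
import Literature.AlgebraicGeometry.Morphisms.FpqcDescentOfMorphisms
import HarnessLib

/-!
# Serre–Tate lifting: the descended maps `B[pⁿ] → X = Y ⧸ β(B[p²])` have TRIVIAL KERNEL, by Drinfeld's stabilisation
# ([Katz1981SerreTate] §1.1 Lemma 1.1.2, §1.2 proof of Thm. 1.2.1; [Tate1967] §2 (2.1))

Topic `Literature/AlgebraicGeometry/GroupSchemes`; namespaces `Literature.AlgebraicGeometry.Morphisms` (§1) and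
`Literature.AlgebraicGeometry.GroupSchemes.BTGroup` (§2–§4).  THEOREMS ONLY (no definition, no named fact, no instance, no notation, no `sorry`).
Cell `hodgecm-mathlib` (D-0151 ∕ D-0183 FLOOR 0), P6 Row 4B «σ2», socket E3 «TOWER» of `Cruxes/HLiu418/Lines/F0_P6b_SerreTateSigma2.lean`, the
sub-line's stub E3K «TRIVIAL KERNEL BY STABILISATION» (desk F0P6b-plan (g13), seat P6b-A4′); generic, count-neutral capital on
`--supports stmt-HodgeConjecture-24832`.  HC_CM is proved only modulo the printed citations until rung 0 closes; nothing here is about HC.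

THE PRINT.  [Katz1981SerreTate] §1.2, proof of Thm. 1.2.1 (p. 142), with §1.1 Lemma 1.1.2 (p. 139): to lift an abelian scheme `X₀` over `A⧸J`
(`A` Artinian local, `p` nilpotent, `𝔪_A · J = 0`) along a lift `B` of its `p`-divisible group, one realises `X` as the quotient of an auxiliary
lift `Y` by the finite flat subgroup `Z = β(B[p²])`, where `β n : B[pⁿ] → Y` lifts `p · (B₀[pⁿ] ↪ X₀)`; the maps `β (n+2)` followed by
`π : Y ↠ X = Y⧸Z` descend along `[p²] : B[pⁿ⁺²] ↠ B[pⁿ]` to `iX n : B[pⁿ] → X`, and «the kernel of `β` is killed by `p²`» (Drinfeld's rigidity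
lemma 1.1.2: the kernel of reduction modulo a square-zero ideal killed by `p` is killed by `p`; the tree's Messing-free ★
`BTGroup.pow_sq_eq_one_of_comp_betaLift_eq_one`) makes `iX n` INJECTIVE, whence `B[pⁿ] ≅ X[pⁿ]`.  [Tate1967] §2 (2.1): `[p^{m−n}] : G_m ↠ G_n` is an
fppf epimorphism with kernel `G_{m−n}` — points of `G_n` lift fppf-locally to `G_m`.

* §1 `Over.exists_fpqc_cover_fac` — `T`-points lift fpqc-locally along a flat, surjective, quasi-compact `q : X ⟶ Y` over `S`: the base change
  `T ×_Y X ⟶ T` is again such and the point lifts on it (Mathlib: these three properties are stable under base change).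
* §2 bookkeeping on the layers of a Barsotti–Tate group: `(pMap ≫ pMap) ≫ i_{n,n+2} = [p²]` (the characterising equation of ★
  `BarsottiTateGroupQuotientMaps`), `i_{k,m} ≫ β m = β k` for an `incl`-compatible family, `pMap` is quasi-compact.
* §3 `eq_one_of_comp_desc_eq_one` — THE ARGUMENT, with the stabilisation «`y ≫ β (n+2) = 1 ⇒ y^{p²} = 1`» as a HYPOTHESIS: for `u ≫ iX = 1`,
  fpqc-locally `u = [p²] w`; `β (n+2) w` is killed by `π`, so lies in `Z`, so fpqc-locally `β (n+2) w = β 2 z = β (n+2) (i_{2,n+2} z)`; then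
  `w ∕ i_{2,n+2} z` is killed by `β (n+2)`, hence by `p²`, hence by `[p²]`, as is `i_{2,n+2} z`; so `[p²] w = 1`, i.e. `u = 1` after an fpqc
  covering, i.e. `u = 1` (★ `FpqcDescentOfMorphisms`: an fpqc covering is an epimorphism).
* §4 `trivialKernel_sigma2` — the sub-line's stub E3K VERBATIM (its `Lines` predicate `IsTorsionTower` spelled by its body), the stabilisation
  discharged by ★ `pow_sq_eq_one_of_comp_betaLift_eq_one` through the base-change squares `B₀ → B`, `X₀ → Y` and the kernel embeddings `i₀`.

## References
* [Katz1981SerreTate] N. M. Katz, *Serre–Tate local moduli*, LNM 868 (1981), Exp. V-bis, §1.1 Lemma 1.1.2 (p. 139), §1.2 proof of Thm. 1.2.1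
  (pp. 141–142).
* [Tate1967] J. Tate, *p-divisible groups*, Proc. Conf. Local Fields (Driebergen 1966), Springer (1967), §2 (2.1) (pp. 161–162).
* [GortzWedhorn2020] U. Görtz, T. Wedhorn, *Algebraic Geometry I* (2nd ed., 2020), Thm. 14.72 (fpqc descent of morphisms), Prop. 14.9.
* [StacksProject] The Stacks Project, Tag 023Q (Descent, Lemma 35.13.7: representable functors are fpqc sheaves).
-/
noncomputable section

-- Mathlib's `Over`/pull-back API is stated across semireducible wrappers (as in the ★ `GroupSchemes/*` files).
set_option backward.isDefEq.respectTransparency false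

universe u

open CategoryTheory CategoryTheory.Limits AlgebraicGeometry MonoidalCategory CartesianMonoidalCategory
open scoped MonObj

namespace Literature.AlgebraicGeometry.Morphisms

/-! ## §1 Points lift fpqc-locally along an fpqc covering -/

/-- **`T`-POINTS LIFT fpqc-LOCALLY ALONG AN fpqc COVERING.**  For `q : X ⟶ Y` over `S` with `q.left` flat, surjective and quasi-compact and any
`T`-point `f : T ⟶ Y`, the base change `c : T' := T ×_Y X ⟶ T` is flat, surjective and quasi-compact and `f` lifts on `T'`:
`w ≫ q = c ≫ f` for the second projection `w : T' ⟶ X`. [cite: GortzWedhorn2020, Thm. 14.72] [cite: StacksProject, Tag 023Q] -/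
theorem Over.exists_fpqc_cover_fac {S : Scheme.{u}} {T X Y : Over S} (f : T ⟶ Y) (q : X ⟶ Y) [Flat q.left] [Surjective q.left]
    [QuasiCompact q.left] :
    ∃ (T' : Over S) (c : T' ⟶ T) (w : T' ⟶ X), Flat c.left ∧ Surjective c.left ∧ QuasiCompact c.left ∧ w ≫ q = c ≫ f := by
  let T' : Over S := Over.mk (pullback.fst f.left q.left ≫ T.hom)
  let c : T' ⟶ T := Over.homMk (pullback.fst f.left q.left) rfl
  have hw : pullback.snd f.left q.left ≫ X.hom = pullback.fst f.left q.left ≫ T.hom := by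
    rw [← Over.w q, ← Category.assoc, ← pullback.condition, Category.assoc, Over.w f]
  let w : T' ⟶ X := Over.homMk (pullback.snd f.left q.left) hw
  refine ⟨T', c, w, ?_, ?_, ?_, Over.OverMorphism.ext ?_⟩
  · change Flat (pullback.fst f.left q.left); infer_instance
  · change Surjective (pullback.fst f.left q.left); infer_instance
  · change QuasiCompact (pullback.fst f.left q.left); infer_instance
  · change pullback.snd f.left q.left ≫ q.left = pullback.fst f.left q.left ≫ f.left
    exact pullback.condition.symm

end Literature.AlgebraicGeometry.Morphisms

namespace Literature.AlgebraicGeometry.GroupSchemes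

namespace BTGroup

variable {p h : ℕ}

/-! ## §2 Bookkeeping on the layers: `[p²] = pMap ≫ pMap`, the transitions carry compatible families -/

/-- `[p²] = pMap (n+1) ≫ pMap n : G (n+2) ↠ G n` satisfies the characterising equation `q ≫ i_{n,n+2} = [p^{(n+2)−n}]` of ★
`BarsottiTateGroupQuotientMaps`. [cite: Tate1967, §2 (2.1) (pp. 161–162)] -/
theorem pMap_succ_comp_pMap_comp_transition {S : Scheme.{u}} (B : BTGroup S p h) (n : ℕ) :
    letI := B.grpObj (n + 1 + 1)
    (B.pMap (n + 1) ≫ B.pMap n) ≫ B.transition (Nat.le_add_right n 2) = (𝟙 (B.G (n + 1 + 1))) ^ (p ^ (n + 2 - n)) := by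
  letI := B.grpObj (n + 1); letI := B.grpObj (n + 1 + 1)
  haveI := B.incl_isMonHom (n + 1)
  have ht : B.transition (Nat.le_add_right n 2) = B.incl n ≫ B.incl (n + 1) := by
    rw [show B.transition (Nat.le_add_right n 2) = B.transition ((Nat.le_add_right n 1).trans (Nat.le_succ (n + 1))) from rfl,
      B.transition_succ_right (Nat.le_add_right n 1), B.transition_succ]
  rw [ht, Nat.add_sub_cancel_left, Category.assoc, reassoc_of% (B.pMap_incl n), MonObj.pow_comp, Category.id_comp, MonObj.comp_pow,
    B.pMap_incl (n + 1), ← pow_mul, sq]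

/-- The transitions carry a compatible family: `i_{k,m} ≫ β m = β k` when `incl n ≫ β (n+1) = β n` for all `n`.
[cite: Tate1967, §2 (2.1) (pp. 161–162)] -/
theorem transition_comp_family {S : Scheme.{u}} (B : BTGroup S p h) {Y : Over S} (β : ∀ n, B.G n ⟶ Y)
    (hβ : ∀ n, B.incl n ≫ β (n + 1) = β n) {k m : ℕ} (hkm : k ≤ m) : B.transition hkm ≫ β m = β k := by
  induction m, hkm using Nat.le_induction with
  | base => rw [transition_self, Category.id_comp]
  | succ m hkm ih => rw [B.transition_succ_right hkm, Category.assoc, hβ m, ih]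

/-- The underlying morphism of `pMap n : G (n+1) ⟶ G n` is quasi-compact (indeed finite: `G (n+1) → S` is finite and `G n → S` separated).
[cite: Tate1967, §2 (2.1) (pp. 161–162)] -/
theorem quasiCompact_pMap_left {S : Scheme.{u}} (B : BTGroup S p h) (n : ℕ) : QuasiCompact (B.pMap n).left := by
  haveI := B.isFinite n; haveI := B.isFinite (n + 1)
  haveI : IsFinite (B.pMap n).left :=
    MorphismProperty.of_postcomp (W := @IsFinite) (W' := @IsSeparated) (B.pMap n).left (B.G n).hom inferInstance
      (by rw [Over.w (B.pMap n)]; infer_instance)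
  infer_instance

/-! ## §3 TRIVIAL KERNEL of the descended maps, the stabilisation as a hypothesis -/

/-- **THE DESCENDED MAP `iX : G n ⟶ X` HAS TRIVIAL KERNEL ON POINTS** ([Katz1981SerreTate] proof of Thm. 1.2.1, the injectivity of
«`B[p^∞]⧸K → A[p^∞]`»).  Setting: `B` a Barsotti–Tate group over `S = Spec A`; `β n : G n ⟶ Y` homomorphisms into a group scheme, compatible with
`incl`; `iZ : Z ⟶ Y` with `b : G 2 ↠ Z` flat, surjective, quasi-compact onto it and `b ≫ iZ = β 2` («`Z = β(B[p²])`»); `π : Y ⟶ X` whose KERNEL ON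
POINTS is `Z` (`u ≫ π = 1 ↔ u` factors through `iZ`); the STABILISATION «`Ker β (n+2)` is killed by `p²`» as a hypothesis; `iX : G n ⟶ X` with
`pMap ≫ pMap ≫ iX = β (n+2) ≫ π`.  THEN `u ≫ iX = 1 → u = 1` for every `T`-point `u` of `G n`.  Proof: fpqc-locally `u = [p²] w` (§1 along
`[p²] = pMap ≫ pMap`); `β (n+2) w ≫ π = 1`, so `β (n+2) w` factors through `Z`, and fpqc-locally through `b`: `β (n+2) w = β 2 z = β (n+2) (i_{2,n+2} z)`;
thus `y := w / i_{2,n+2} z` is killed by `β (n+2)`, hence by `p²` (stabilisation), hence by `[p²]`; and `i_{2,n+2} z` is killed by `[p²]` too; so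
`[p²] w = 1` fpqc-locally, i.e. `u = 1` after an fpqc covering — and `u = 1` on `T` (★ `SchemeOver.hom_ext_of_fpqc`).
[cite: Katz1981SerreTate, Lemma 1.1.2 and proof of Theorem 1.2.1 (pp. 139–142)] [cite: Tate1967, §2 (2.1) (pp. 161–162)] -/
theorem eq_one_of_comp_desc_eq_one {A : Type u} [CommRing A] (B : BTGroup (Spec (.of A)) p h) {Y X Z : Over (Spec (.of A))}
    [GrpObj Y] [GrpObj X] (β : ∀ n, B.G n ⟶ Y) (hβ : ∀ n, letI := B.grpObj n; IsMonHom (β n))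
    (hβincl : ∀ n, B.incl n ≫ β (n + 1) = β n) (iZ : Z ⟶ Y) (b : B.G 2 ⟶ Z) [Flat b.left] [Surjective b.left] [QuasiCompact b.left]
    (hbiZ : b ≫ iZ = β 2) (π : Y ⟶ X) (hker : ∀ (T : Over (Spec (.of A))) (u : T ⟶ Y), u ≫ π = 1 ↔ ∃ v : T ⟶ Z, v ≫ iZ = u) (n : ℕ)
    (hstab : ∀ (T : Over (Spec (.of A))) (y : T ⟶ B.G (n + 2)), y ≫ β (n + 2) = 1 → (letI := B.grpObj (n + 2); y ^ (p ^ 2) = 1))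
    (iX : B.G n ⟶ X) (hdesc : B.pMap (n + 1) ≫ B.pMap n ≫ iX = β (n + 2) ≫ π) {T : Over (Spec (.of A))} (u : T ⟶ B.G n)
    (hu : u ≫ iX = 1) : letI := B.grpObj n; u = 1 := by
  letI := B.grpObj n; letI := B.grpObj (n + 1); letI := B.grpObj (n + 1 + 1); letI := B.grpObj 2
  haveI := hβ (n + 2)
  -- the quotient map `q = [p²] : G (n+2) ↠ G n`
  have hq := B.pMap_succ_comp_pMap_comp_transition n
  haveI : IsMonHom (B.pMap (n + 1) ≫ B.pMap n) := B.isMonHom_of_comp_transition_eq_pow (Nat.le_add_right n 2) hq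
  haveI : Flat (B.pMap (n + 1) ≫ B.pMap n).left := B.flat_left_of_comp_transition_eq_pow (Nat.le_add_right n 2) hq
  haveI : Surjective (B.pMap (n + 1) ≫ B.pMap n).left := B.surjective_left_of_comp_transition_eq_pow (Nat.le_add_right n 2) hq
  haveI : QuasiCompact (B.pMap (n + 1) ≫ B.pMap n).left := by
    haveI := B.quasiCompact_pMap_left n; haveI := B.quasiCompact_pMap_left (n + 1)
    rw [Over.comp_left]; infer_instance
  -- Step 1: fpqc-locally `u = [p²] w`
  obtain ⟨T₁, c₁, w, hc₁f, hc₁s, hc₁q, hw⟩ :=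
    Literature.AlgebraicGeometry.Morphisms.Over.exists_fpqc_cover_fac u (B.pMap (n + 1) ≫ B.pMap n)
  -- Step 2: `β (n+2) w` is killed by `π`, so factors through `Z`
  have hwπ : (w ≫ β (n + 2)) ≫ π = 1 := by
    rw [Category.assoc, ← hdesc, reassoc_of% hw, hu, MonObj.comp_one]
  obtain ⟨v, hv⟩ := (hker T₁ (w ≫ β (n + 2))).1 hwπ
  -- Step 3: fpqc-locally `v = b z`
  obtain ⟨T₂, c₂, z, hc₂f, hc₂s, hc₂q, hz⟩ := Literature.AlgebraicGeometry.Morphisms.Over.exists_fpqc_cover_fac v b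
  -- Step 4: `y := (c₂ ≫ w) / (z ≫ i_{2,n+2})` is killed by `β (n+2)`
  have h2 : 2 ≤ n + 2 := Nat.le_add_left 2 n
  have hzt : (z ≫ B.transition h2) ≫ β (n + 2) = c₂ ≫ w ≫ β (n + 2) := by
    rw [Category.assoc, B.transition_comp_family β hβincl h2, ← hbiZ, reassoc_of% hz, hv]
  have hy : ((c₂ ≫ w) / (z ≫ B.transition h2)) ≫ β (n + 2) = 1 := by
    rw [GrpObj.div_comp, hzt, Category.assoc, div_self']
  -- Step 5: stabilisation — `y` is killed by `p²`, hence by `[p²]`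
  have hy2 : ((c₂ ≫ w) / (z ≫ B.transition h2)) ^ (p ^ 2) = 1 := hstab T₂ _ hy
  have hyq : ((c₂ ≫ w) / (z ≫ B.transition h2)) ≫ (B.pMap (n + 1) ≫ B.pMap n) = 1 := by
    rw [B.comp_eq_one_iff_pow_eq_one (Nat.le_add_right n 2) hq, Nat.add_sub_cancel_left]
    exact hy2
  -- … and so is `i_{2,n+2} z`
  have hztq : (z ≫ B.transition h2) ≫ (B.pMap (n + 1) ≫ B.pMap n) = 1 := by
    rw [B.comp_eq_one_iff_pow_eq_one (Nat.le_add_right n 2) hq, Nat.add_sub_cancel_left]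
    exact B.comp_transition_pow_eq_one h2 z
  -- Step 6: hence `[p²] (c₂ ≫ w) = 1`, i.e. `u = 1` after the fpqc covering `c₂ ≫ c₁`
  have hwq : (c₂ ≫ w) ≫ (B.pMap (n + 1) ≫ B.pMap n) = 1 := by
    have e : c₂ ≫ w = ((c₂ ≫ w) / (z ≫ B.transition h2)) * (z ≫ B.transition h2) := (div_mul_cancel _ _).symm
    rw [e, MonObj.mul_comp, hyq, hztq, mul_one]
  have hcu : (c₂ ≫ c₁) ≫ u = (c₂ ≫ c₁) ≫ (1 : T ⟶ B.G n) := by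
    rw [MonObj.comp_one, Category.assoc, ← hw, ← Category.assoc, hwq]
  -- Step 7: descend the equality along the fpqc covering
  haveI : Flat (c₂ ≫ c₁).left := by rw [Over.comp_left]; infer_instance
  haveI : Surjective (c₂ ≫ c₁).left := by rw [Over.comp_left]; infer_instance
  haveI : QuasiCompact (c₂ ≫ c₁).left := by rw [Over.comp_left]; infer_instance
  exact Literature.AlgebraicGeometry.Morphisms.SchemeOver.hom_ext_of_fpqc (c₂ ≫ c₁) hcu


/-! ## §4 The σ2 sub-line's stub E3K, in its own binders -/

/-- **STUB E3K «TRIVIAL KERNEL BY STABILISATION» OF THE σ2 SUB-LINE, IN THE SOCKET'S OWN BINDERS** (the statement of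
`F0P6bSigma2TowerOfQuotient.stub_E3K_trivialKernel` of `Cruxes/HLiu418/Lines`, VERBATIM except that the `Lines`-side predicate
`F0P6bBTSerreTateDefs.IsTorsionTower X₀ B₀ i₀` is spelled by its body — a Literature file cannot import it; the two statements are δ-convertible).
In the Serre–Tate setting (`A` Artinian local, `(p : A)` nilpotent, `𝔪_A · J = 0`; `B₀ = X₀[p^∞]` via the kernel embeddings `i₀`; `B`, `Y` lifts of
`B₀`, `X₀` as base-change squares; `β n : B[pⁿ] → Y` homomorphisms lifting `p · i₀ n`; `Z = β(B[p²]) ↪ Y` with `b : B[p²] ↠ Z` flat surjective;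
`π : Y ↠ X` with kernel `Z` on points) ANY family `iX n : B[pⁿ] → X` with `pMap ≫ pMap ≫ iX n = β (n+2) ≫ π` has TRIVIAL KERNEL on `T`-points.
This is §3 `eq_one_of_comp_desc_eq_one`, the stabilisation hypothesis being DISCHARGED by the Messing-free ★
`BTGroup.pow_sq_eq_one_of_comp_betaLift_eq_one` («`u ≫ β n = 1 ⇒ u^{p²} = 1`», Drinfeld's rigidity ★ `ReductionKernel.pow_eq_one_of_isPullback`
through the base-change squares `c`, `GY` and the monomorphisms `i₀ n`); `b.left` is quasi-compact because `B[p²] → S` is finite and `Z → S` separated.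
Idle binders: `p.Prime`, `IsArtinianRing A`, the relative dimensions, `incl ≫ i₀ = i₀`, `IsClosedImmersion iZ.left`, `Flat Z.hom`, the four
properties of `π`, `IsMonHom (iX n)`. [cite: Katz1981SerreTate, Lemma 1.1.2 and proof of Theorem 1.2.1 (pp. 139–142)]
[cite: Tate1967, §2 (2.1) (pp. 161–162)] -/
theorem trivialKernel_sigma2 :
    ∀ (p : ℕ), p.Prime → ∀ (A : Type) [CommRing A] [IsArtinianRing A] [IsLocalRing A], IsNilpotent (p : A) →
      ∀ (J : Ideal A), J ≠ ⊤ → IsLocalRing.maximalIdeal A * J = ⊥ →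
      ∀ (g : ℕ) (X₀ : AbelianSchemes.AbelianSchemeOver (Spec (.of (A ⧸ J)))), X₀.IsOfRelDim g →
      ∀ (B₀ : BTGroup (Spec (.of (A ⧸ J))) p (2 * g)) (i₀ : ∀ n, B₀.G n ⟶ X₀.X),
        ((∀ n, letI := B₀.grpObj n; IsMonHom (i₀ n)) ∧
          (∀ n, IsPullback (i₀ n) (toUnit (B₀.G n)) (((𝟙 X₀.X : X₀.X ⟶ X₀.X) ^ (p ^ n) : X₀.X ⟶ X₀.X)) η[X₀.X]) ∧
          (∀ n, B₀.incl n ≫ i₀ (n + 1) = i₀ n)) →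
      ∀ (B : BTGroup (Spec (.of A)) p (2 * g)) (c : ∀ n, (B₀.G n).left ⟶ (B.G n).left),
        B₀.IsBaseChangeVia B (Spec.map (CommRingCat.ofHom (Ideal.Quotient.mk J))) c →
      ∀ (Y : AbelianSchemes.AbelianSchemeOver (Spec (.of A))), Y.IsOfRelDim g → ∀ (GY : X₀.X.left ⟶ Y.X.left),
        X₀.IsBaseChangeVia Y (Spec.map (CommRingCat.ofHom (Ideal.Quotient.mk J))) GY →
      ∀ (β : ∀ n, B.G n ⟶ Y.X), (∀ n, letI := B.grpObj n; IsMonHom (β n)) → (∀ n, B.incl n ≫ β (n + 1) = β n) →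
        (∀ n, c n ≫ (β n).left = ((i₀ n) ^ p).left ≫ GY) →
      ∀ (Z : Over (Spec (.of A))) (iZ : Z ⟶ Y.X) (b : B.G 2 ⟶ Z), IsClosedImmersion iZ.left → IsFinite Z.hom → Flat Z.hom →
        b ≫ iZ = β 2 → Flat b.left → Surjective b.left →
      ∀ (X : AbelianSchemes.AbelianSchemeOver (Spec (.of A))), X.IsOfRelDim g → ∀ (π : Y.X ⟶ X.X), IsMonHom π → IsFinite π.left →
        Flat π.left → Surjective π.left → (∀ (T : Over (Spec (.of A))) (u : T ⟶ Y.X), u ≫ π = 1 ↔ ∃ v : T ⟶ Z, v ≫ iZ = u) →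
      ∀ (iX : ∀ n, B.G n ⟶ X.X), (∀ n, letI := B.grpObj n; IsMonHom (iX n)) →
        (∀ n, B.pMap (n + 1) ≫ B.pMap n ≫ iX n = β (n + 2) ≫ π) →
        ∀ (n : ℕ) (T : Over (Spec (.of A))) (u : T ⟶ B.G n), u ≫ iX n = 1 → (letI := B.grpObj n; u = 1) := by
  intro p _ A _ _ _ hpA J hJ hmJ g X₀ _ B₀ i₀ hT B c hBc Y _ GY hGY β hβ hβincl hβlift Z iZ b _ hZf _ hbiZ hbf hbs X _ π _ _ _ _ hker
    iX _ hdesc n T u hu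
  -- `b.left` is quasi-compact: `b.left ≫ (Z → S) = (B[p²] → S)` is finite and `Z → S` is separated
  haveI := hZf; haveI := hbf; haveI := hbs
  haveI := B.isFinite 2
  haveI : IsFinite b.left :=
    MorphismProperty.of_postcomp (W := @IsFinite) (W' := @IsSeparated) b.left Z.hom inferInstance (by rw [Over.w b]; infer_instance)
  -- the stabilisation «`Ker β (n+2)` is killed by `p²`» is ★ `pow_sq_eq_one_of_comp_betaLift_eq_one`
  exact B.eq_one_of_comp_desc_eq_one β hβ hβincl iZ b hbiZ π hker n
    (fun T' y hy => pow_sq_eq_one_of_comp_betaLift_eq_one hpA hJ hmJ X₀ B₀ i₀ hT.1 hT.2.1 B c hBc Y GY hGY β hβlift (n + 2) y hy)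
    (iX n) (hdesc n) u hu

end BTGroup

end Literature.AlgebraicGeometry.GroupSchemes

end
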